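import Literature.Topology.FourManifolds.PlanarArch
import Mathlib.Analysis.SpecialFunctions.Sqrt
import HarnessLib

/-!
# A foliated band chart whose middle line lies on a round circle

Topic `Literature/Topology/FourManifolds`; a brick of the decomposition of the Fox–Milnor
congruence `Literature.Topology.FourManifolds.Knot.IsConnectedSum.isConcordant` (construction of
an explicit connected sum inside a tube chart, `BandSumConcordanceCore.lean`). A connected-sum
presentation (`Knot.IsConnectedSum`, `BandSum.lean`) requires a band whose *middle line*
`x₀ = 1/2` is exactly the intersection of the band with the splitting sphere. When the splitting
sphere is round (as it is when it is the image of the equator under affine chart maps) and the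
band lies in a plane, the band therefore cannot be ruled by straight lines; this file builds a
planar band chart `B : ℝ² → ℝ³` foliated by the graphs of a one-parameter family of functions
interpolating between the core line `d₁ = 0` (left edge, `x₀ = 0`), the lower arc of the circle
(middle line, `x₀ = 1/2`) and the line `d₁ = a` (right edge, `x₀ = 1`). Everything is proved:

* `BandFoliation.H q s = q s / ((2q - 1) s + 1 - q)` — the projective interpolation through
  `(0,0)`, `(1/2, q)`, `(1, 1)`: jointly `C^∞` off its pole, with `∂ₛ H = q(1-q)/den² > 0`,
  strictly increasing on the pole-free half-line `s ≥ -(1-q)/2` (`q ∈ (1/2, 1)`), and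
  `H q s = q ↔ s = 1/2` there (`H_eq_iff`).
* `BandFoliation.circLow mθ md r` — the lower arc of a circle as a graph; a point of the circle
  below the upper arc is on it (`eq_circLow_of_mem`); `C^∞` over the open diameter.
* `BandFoliation.leaf a g s = a H (g/a) s` — the leaves; `leaf_zero/one/half`, `leaf_eq_iff`,
  `deriv_leaf_pos`, `strictMonoOn_leaf`, `leaf_mem`, and the bound `leaf_le` slightly beyond the
  top edge.
* `BandFoliation.ChartData` — the numerical data of a chart (height `a`, circle, `θ`-interval,
  collar width `δ ≤ 1/8`) with the inequalities that make it work on the doubled `θ`-interval;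
  `θaff` (affine `x₁ ↦ θ`), the clamps `clampS`, `clamp` (`exists_contDiff_clamp`, so that the
  chart is globally `C^∞` while unchanged on the collar), `Θ`, `G`, `F`, and
  **the chart `B x = (Θ x, F x, 0)`**: `C^∞` (`contDiff_B`), left edge on the core line
  (`F_of_zero`), right edge at height `a` (`F_of_one`), middle line on the circle (`F_of_half`)
  and **conversely the chart meets the circle only in its middle line** (`mem_circle_iff`);
  injective on the closed collar (`injOn_B`) and an immersion on the open collar
  (`injective_fderiv_B`).

## References

* P. R. Cromwell, *Knots and Links* (2004), §4.6 (bands of a connected sum crossing the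
  splitting sphere in an arc). [Cromwell2004]
* R. H. Fox, J. W. Milnor, Osaka J. Math. 3 (1966), §1 (the consumer). [FoxMilnor1966]

## Design notes

All statements are elementary real analysis, `[folklore]`; the smooth step and clamp come from
`PlanarArch.lean`. No named facts, no `sorry`.
-/

open Set Function
open scoped Topology ContDiff

noncomputable section

namespace Literature.Topology.FourManifolds

namespace BandFoliation

/-! ### The projective interpolation `H q s = q s / ((2q - 1) s + 1 - q)` -/

/-- The denominator of the projective interpolation. [folklore] -/
def den (q s : ℝ) : ℝ := (2 * q - 1) * s + (1 - q)

/-- **The projective interpolation** through `(0, 0)`, `(1/2, q)`, `(1, 1)`: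
`H q s = q s / ((2q - 1) s + 1 - q)`. [folklore] -/
def H (q s : ℝ) : ℝ := q * s / den q s

/-- `H q 0 = 0`. [folklore] -/
@[simp] theorem H_zero (q : ℝ) : H q 0 = 0 := by simp [H]

/-- `H q 1 = 1` (for `q ≠ 0`). [folklore] -/
theorem H_one {q : ℝ} (hq : q ≠ 0) : H q 1 = 1 := by
  rw [H, den]
  have : (2 * q - 1) * 1 + (1 - q) = q := by ring
  rw [this, mul_one, div_self hq]

/-- `H q (1/2) = q` (for `q ≠ 0`... in fact always). [folklore] -/
theorem H_half (q : ℝ) : H q (1 / 2) = q := by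
  rw [H, den]
  have : (2 * q - 1) * (1 / 2) + (1 - q) = 1 / 2 := by ring
  rw [this]; field_simp

/-- The pole of `H q`: `den q s = 0` iff `s = -(1 - q)/(2q - 1)`; for `q ∈ (1/2, 1)` and
`s > -(1 - q)/(2q - 1)` the denominator is positive. [folklore] -/
theorem den_pos {q s : ℝ} (hq : 1 / 2 < q) (hs : -(1 - q) / (2 * q - 1) < s) : 0 < den q s := by
  rw [den]
  have h2 : 0 < 2 * q - 1 := by linarith
  rw [div_lt_iff₀ h2] at hs
  nlinarith

/-- On `s ≥ -(1 - q)/2` the denominator is positive, for `q ∈ (1/2, 1)` (the pole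
`-(1 - q)/(2q - 1)` lies left of `-(1 - q)/2`). [folklore] -/
theorem den_pos_of_ge {q s : ℝ} (hq : 1 / 2 < q) (hq1 : q < 1) (hs : -(1 - q) / 2 ≤ s) :
    0 < den q s := by
  refine den_pos hq (lt_of_lt_of_le ?_ hs)
  have h2 : 0 < 2 * q - 1 := by linarith
  rw [div_lt_div_iff₀ h2 two_pos]
  nlinarith

/-- **The `s`-derivative of `H`**: `∂ₛ H = q (1 - q) / den²`. [folklore] -/
theorem hasDerivAt_H {q s : ℝ} (hd : den q s ≠ 0) :
    HasDerivAt (H q) (q * (1 - q) / den q s ^ 2) s := by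
  have h1 : HasDerivAt (fun s ↦ q * s) q s := by simpa using (hasDerivAt_id s).const_mul q
  have h2 : HasDerivAt (den q) (2 * q - 1) s := by
    unfold den
    simpa using ((hasDerivAt_id s).const_mul (2 * q - 1)).add_const (1 - q)
  have h := h1.div h2 hd
  refine h.congr_deriv ?_
  rw [den]; ring

/-- `∂ₛ H > 0` where the denominator is nonzero and `q ∈ (0, 1)`. [folklore] -/
theorem deriv_H_pos {q s : ℝ} (hq0 : 0 < q) (hq1 : q < 1) (hd : den q s ≠ 0) :
    0 < deriv (H q) s := by
  rw [(hasDerivAt_H hd).deriv]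
  exact div_pos (mul_pos hq0 (by linarith)) (by positivity)

/-- `H` is jointly `C^∞` in `(q, s)` off the pole. [folklore] -/
theorem contDiffAt_H {q s : ℝ} (hd : den q s ≠ 0) :
    ContDiffAt ℝ ∞ (fun p : ℝ × ℝ ↦ H p.1 p.2) (q, s) := by
  unfold H den
  have hnum : ContDiff ℝ ∞ fun p : ℝ × ℝ ↦ p.1 * p.2 := contDiff_fst.mul contDiff_snd
  have hden : ContDiff ℝ ∞ fun p : ℝ × ℝ ↦ (2 * p.1 - 1) * p.2 + (1 - p.1) :=
    ((contDiff_const.mul contDiff_fst).sub contDiff_const).mul contDiff_snd |>.add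
      (contDiff_const.sub contDiff_fst)
  exact hnum.contDiffAt.div hden.contDiffAt hd

/-- **`H q` is strictly increasing on the pole-free half-line** `[-(1 - q)/2, ∞)`, for
`q ∈ (1/2, 1)`. [folklore] -/
theorem strictMonoOn_H {q : ℝ} (hq : 1 / 2 < q) (hq1 : q < 1) :
    StrictMonoOn (H q) (Ici (-(1 - q) / 2)) := by
  refine strictMonoOn_of_deriv_pos (convex_Ici _) ?_ fun s hs ↦ ?_
  · intro s hs
    have hd := (den_pos_of_ge hq hq1 hs).ne'
    exact (hasDerivAt_H hd).continuousAt.continuousWithinAt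
  · rw [interior_Ici] at hs
    exact deriv_H_pos (by linarith) hq1 (den_pos_of_ge hq hq1 hs.le).ne'

/-- **`H q s = q` iff `s = 1/2`** on the pole-free half-line. [folklore] -/
theorem H_eq_iff {q s : ℝ} (hq : 1 / 2 < q) (hq1 : q < 1) (hs : -(1 - q) / 2 ≤ s) :
    H q s = q ↔ s = 1 / 2 := by
  constructor
  · intro h
    have h' : H q s = H q (1 / 2) := by rw [H_half]; exact h
    exact (strictMonoOn_H hq hq1).injOn hs (show -(1 - q) / 2 ≤ (1 : ℝ) / 2 by linarith) h'
  · rintro rfl; exact H_half q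

/-! ### The lower arc of a circle as a graph -/

/-- The **lower arc** of the circle with centre `(mθ, md)` and radius `r`, as a graph over the
first coordinate: `θ ↦ md - √(r² - (θ - mθ)²)`. [folklore] -/
def circLow (mθ md r θ : ℝ) : ℝ := md - Real.sqrt (r ^ 2 - (θ - mθ) ^ 2)

/-- Points of the lower arc lie on the circle. [folklore] -/
theorem circLow_mem {mθ md r θ : ℝ} (h : (θ - mθ) ^ 2 ≤ r ^ 2) :
    (θ - mθ) ^ 2 + (circLow mθ md r θ - md) ^ 2 = r ^ 2 := by
  rw [circLow, show md - Real.sqrt (r ^ 2 - (θ - mθ) ^ 2) - md = -Real.sqrt (r ^ 2 - (θ - mθ) ^ 2) by ring,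
    neg_sq, Real.sq_sqrt (by linarith)]
  ring

/-- **A point of the circle below the upper arc is on the lower arc.** [folklore] -/
theorem eq_circLow_of_mem {mθ md r θ d : ℝ} (h : (θ - mθ) ^ 2 + (d - md) ^ 2 = r ^ 2)
    (hd : d < md + Real.sqrt (r ^ 2 - (θ - mθ) ^ 2)) : d = circLow mθ md r θ := by
  have h1 : (d - md) ^ 2 = Real.sqrt (r ^ 2 - (θ - mθ) ^ 2) ^ 2 := by
    rw [Real.sq_sqrt (by nlinarith [sq_nonneg (d - md)])]; linarith
  rcases sq_eq_sq_iff_eq_or_eq_neg.1 h1 with h2 | h2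
  · exact absurd h2 (by linarith)
  · rw [circLow]; linarith

/-- The lower arc is `C^∞` at points over the open diameter. [folklore] -/
theorem contDiffAt_circLow {mθ md r θ : ℝ} (h : (θ - mθ) ^ 2 < r ^ 2) :
    ContDiffAt ℝ ∞ (circLow mθ md r) θ := by
  unfold circLow
  refine contDiffAt_const.sub ?_
  exact (contDiffAt_const.sub ((contDiffAt_id.sub contDiffAt_const).pow 2)).sqrt
    (by simp only [id]; linarith)

/-! ### The leaves -/

/-- **The leaf function** `f a g s = a · H (g / a) s`: for fixed `g ∈ (a/2, a)` a strictly
increasing function of `s` through `(0, 0)`, `(1/2, g)` and `(1, a)`. [folklore] -/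
def leaf (a g s : ℝ) : ℝ := a * H (g / a) s

/-- The bottom leaf is the core line: `leaf a g 0 = 0`. [folklore] -/
@[simp] theorem leaf_zero (a g : ℝ) : leaf a g 0 = 0 := by simp [leaf]

/-- The top leaf is the line at height `a`: `leaf a g 1 = a` (for `g ≠ 0`, `a ≠ 0`). [folklore] -/
theorem leaf_one {a g : ℝ} (ha : a ≠ 0) (hg : g ≠ 0) : leaf a g 1 = a := by
  rw [leaf, H_one (div_ne_zero hg ha), mul_one]

/-- The middle leaf passes through height `g`: `leaf a g (1/2) = g` (for `a ≠ 0`). [folklore] -/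
theorem leaf_half {a g : ℝ} (ha : a ≠ 0) : leaf a g (1 / 2) = g := by
  rw [leaf, H_half]; field_simp

/-- **The leaf through a point at height `g` is the middle one**: for `g ∈ (a/2, a)` and `s` in
the pole-free half-line, `leaf a g s = g ↔ s = 1/2`. [folklore] -/
theorem leaf_eq_iff {a g s : ℝ} (ha : 0 < a) (hg : a / 2 < g) (hg' : g < a)
    (hs : -(1 - g / a) / 2 ≤ s) : leaf a g s = g ↔ s = 1 / 2 := by
  have hq : 1 / 2 < g / a := by rw [lt_div_iff₀ ha]; linarith
  have hq1 : g / a < 1 := by rw [div_lt_one ha]; exact hg'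
  rw [← H_eq_iff hq hq1 hs, leaf]
  constructor
  · intro h
    have h2 : a * H (g / a) s / a = g / a := by rw [h]
    rwa [mul_div_cancel_left₀ _ ha.ne'] at h2
  · intro h; rw [h]; field_simp

/-- **The leaves increase with `s`**: positive `s`-derivative on the pole-free half-line.
[folklore] -/
theorem deriv_leaf_pos {a g s : ℝ} (ha : 0 < a) (hg : a / 2 < g) (hg' : g < a)
    (hs : -(1 - g / a) / 2 ≤ s) : 0 < deriv (leaf a g) s := by
  have hq : 1 / 2 < g / a := by rw [lt_div_iff₀ ha]; linarith
  have hq1 : g / a < 1 := by rw [div_lt_one ha]; exact hg'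
  have hd := (den_pos_of_ge hq hq1 hs).ne'
  rw [show leaf a g = fun s ↦ a * H (g / a) s from rfl, deriv_const_mul _ (hasDerivAt_H hd).differentiableAt]
  exact mul_pos ha (deriv_H_pos (by linarith) hq1 hd)

/-- The leaves are strictly increasing in `s` on the pole-free half-line. [folklore] -/
theorem strictMonoOn_leaf {a g : ℝ} (ha : 0 < a) (hg : a / 2 < g) (hg' : g < a) :
    StrictMonoOn (leaf a g) (Ici (-(1 - g / a) / 2)) := by
  have hq : 1 / 2 < g / a := by rw [lt_div_iff₀ ha]; linarith
  have hq1 : g / a < 1 := by rw [div_lt_one ha]; exact hg'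
  intro s hs t ht hst
  exact mul_lt_mul_of_pos_left (strictMonoOn_H hq hq1 hs ht hst) ha

/-- Values of the leaves between the core line and the top line: for `s ∈ [0, 1]`,
`leaf a g s ∈ [0, a]`. [folklore] -/
theorem leaf_mem {a g s : ℝ} (ha : 0 < a) (hg : a / 2 < g) (hg' : g < a) (hs : s ∈ Icc (0 : ℝ) 1) :
    leaf a g s ∈ Icc (0 : ℝ) a := by
  have hmono := (strictMonoOn_leaf ha hg hg').monotoneOn
  have hq1 : g / a < 1 := by rw [div_lt_one ha]; exact hg'
  have h0 : -(1 - g / a) / 2 ≤ 0 := by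
    have : 0 ≤ 1 - g / a := by linarith
    linarith
  constructor
  · have := hmono (show (0:ℝ) ∈ Ici (-(1 - g / a) / 2) from h0) (show s ∈ Ici _ from le_trans h0 hs.1) hs.1
    rwa [leaf_zero] at this
  · have h1 : (1 : ℝ) ∈ Ici (-(1 - g / a) / 2) := le_trans h0 zero_le_one
    have := hmono (show s ∈ Ici (-(1 - g / a) / 2) from le_trans h0 hs.1) h1 hs.2
    rwa [leaf_one ha.ne' (by linarith : g ≠ 0)] at this

/-- The leaf function is jointly `C^∞` in `(g, s)` off the pole (for `a ≠ 0`). [folklore] -/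
theorem contDiffAt_leaf {a g s : ℝ} (hd : den (g / a) s ≠ 0) :
    ContDiffAt ℝ ∞ (fun p : ℝ × ℝ ↦ leaf a p.1 p.2) (g, s) := by
  unfold leaf
  have h1 : ContDiffAt ℝ ∞ (fun p : ℝ × ℝ ↦ (p.1 / a, p.2)) (g, s) :=
    ((contDiffAt_fst.div_const a).prodMk contDiffAt_snd)
  have h2 : ContDiffAt ℝ ∞ ((fun p : ℝ × ℝ ↦ H p.1 p.2) ∘ fun p : ℝ × ℝ ↦ (p.1 / a, p.2)) (g, s) :=
    (contDiffAt_H hd).comp (g, s) h1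
  exact contDiffAt_const.mul h2

/-- **Upper bound for the leaves slightly beyond the top edge**: for `q = g/a ∈ (1/2, 1)` and
`s ≤ 1 + 2δ` (`0 ≤ δ`), `leaf a g s ≤ a + 4 δ (a - g)`. [folklore] -/
theorem leaf_le {a g s δ : ℝ} (ha : 0 < a) (hg : a / 2 < g) (hg' : g < a) (hδ : 0 ≤ δ)
    (hs₀ : -(1 - g / a) / 2 ≤ s) (hs : s ≤ 1 + 2 * δ) : leaf a g s ≤ a + 4 * δ * (a - g) := by
  have hq : 1 / 2 < g / a := by rw [lt_div_iff₀ ha]; linarith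
  have hq1 : g / a < 1 := by rw [div_lt_one ha]; exact hg'
  -- monotonicity reduces to `s = 1 + 2δ`
  have h1 : leaf a g s ≤ leaf a g (1 + 2 * δ) :=
    (strictMonoOn_leaf ha hg hg').monotoneOn hs₀ (show -(1 - g / a) / 2 ≤ 1 + 2 * δ by
      have : 0 ≤ 1 - g / a := by linarith
      change _ ≤ _; linarith) hs
  refine h1.trans ?_
  -- `H q t - 1 = (1 - q)(t - 1)/den ≤ 2 (1 - q)(t - 1)` for `t ≥ 1` since `den ≥ q > 1/2`
  rw [leaf]
  set q := g / a with hqdef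
  have hden : q ≤ den q (1 + 2 * δ) := by rw [den]; nlinarith
  have hdpos : 0 < den q (1 + 2 * δ) := by linarith
  have hH : H q (1 + 2 * δ) ≤ 1 + 4 * δ * (1 - q) := by
    rw [H, div_le_iff₀ hdpos, den]
    have h2q : (0 : ℝ) ≤ 2 * q - 1 := by linarith
    have h1q : (0 : ℝ) ≤ 1 - q := by linarith
    nlinarith [mul_nonneg (mul_nonneg hδ h1q) h2q, mul_nonneg (mul_nonneg (sq_nonneg δ) h1q) h2q]
  have hga : a - g = a * (1 - q) := by rw [hqdef]; field_simp
  rw [hga]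
  nlinarith [mul_le_mul_of_nonneg_left hH ha.le]

/-! ### The foliated band chart -/

/-- **Data of a foliated band chart.** A height `a > 0` (the top edge `d₁ = a`), a circle of
centre `(mθ, md)` and radius `r` in the plane, a `θ`-interval `[θlo, θhi]` (the band) and a
collar width `δ`, such that over the doubled `θ`-interval the lower arc of the circle runs
strictly between the heights `a/2` and `a` with room `8 δ a ≤ a - arc`, inside the open
diameter, and the upper arc passes above the slightly extended leaves. [folklore] -/
structure ChartData where
  /-- The height of the top edge. -/
  a : ℝ
  /-- The `θ`-coordinate of the centre of the circle. -/
  mθ : ℝ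
  /-- The height of the centre of the circle. -/
  md : ℝ
  /-- The radius of the circle. -/
  r : ℝ
  /-- The left end of the band. -/
  θlo : ℝ
  /-- The right end of the band. -/
  θhi : ℝ
  /-- The collar width. -/
  δ : ℝ
  a_pos : 0 < a
  δ_pos : 0 < δ
  δ_le : δ ≤ 1 / 8
  θlo_lt : θlo < θhi
  sq_lt : ∀ θ ∈ Icc (θlo - (θhi - θlo)) (θhi + (θhi - θlo)), (θ - mθ) ^ 2 < r ^ 2
  low_gt : ∀ θ ∈ Icc (θlo - (θhi - θlo)) (θhi + (θhi - θlo)), a / 2 < circLow mθ md r θ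
  low_lt : ∀ θ ∈ Icc (θlo - (θhi - θlo)) (θhi + (θhi - θlo)), circLow mθ md r θ < a
  room : ∀ θ ∈ Icc (θlo - (θhi - θlo)) (θhi + (θhi - θlo)), 8 * δ * a ≤ a - circLow mθ md r θ
  up : ∀ θ ∈ Icc (θlo - (θhi - θlo)) (θhi + (θhi - θlo)),
    a + 4 * δ * (a - circLow mθ md r θ) < md + Real.sqrt (r ^ 2 - (θ - mθ) ^ 2)

namespace ChartData

variable (C : ChartData)

/-- The doubled `θ`-interval. [folklore] -/
def I2 : Set ℝ := Icc (C.θlo - (C.θhi - C.θlo)) (C.θhi + (C.θhi - C.θlo))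

/-- The width of the band in `θ`. [folklore] -/
def wid : ℝ := C.θhi - C.θlo

/-- The width is positive. [folklore] -/
theorem wid_pos : 0 < C.wid := by rw [wid]; linarith [C.θlo_lt]

/-- **The affine coordinate** `x₁ ↦ θ`: `θlo` at `x₁ = -δ`, `θhi` at `x₁ = 1 + δ`. [folklore] -/
def θaff (x₁ : ℝ) : ℝ := C.θlo + (x₁ + C.δ) * (C.wid / (1 + 2 * C.δ))

/-- The slope of the affine coordinate is positive. [folklore] -/
theorem slope_pos : 0 < C.wid / (1 + 2 * C.δ) := div_pos C.wid_pos (by linarith [C.δ_pos])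

/-- `θaff (-δ) = θlo`. [folklore] -/
@[simp] theorem θaff_neg_δ : C.θaff (-C.δ) = C.θlo := by simp [θaff]

/-- `θaff (1 + δ) = θhi`. [folklore] -/
@[simp] theorem θaff_one_add_δ : C.θaff (1 + C.δ) = C.θhi := by
  rw [θaff]
  have hne : (1 + 2 * C.δ) ≠ 0 := by linarith [C.δ_pos]
  have : (1 + C.δ + C.δ) * (C.wid / (1 + 2 * C.δ)) = C.wid := by
    rw [show 1 + C.δ + C.δ = 1 + 2 * C.δ by ring]; field_simp
  rw [this, wid]; ring

/-- The affine coordinate is injective. [folklore] -/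
theorem θaff_injective : Injective C.θaff := by
  intro x y h
  rw [θaff, θaff, add_right_inj] at h
  exact (mul_left_injective₀ C.slope_pos.ne' h) |> fun h' ↦ by linarith

/-- The affine coordinate maps `[-2δ', 1 + 2δ']`-ish collars into the doubled interval:
for `x₁ ∈ [-1 - δ, 2 + δ]`... precisely, `x₁ ∈ [-(1 + 3δ), 2 + 3δ]` lands in `I2`. [folklore] -/
theorem θaff_mem_I2 {x₁ : ℝ} (hx : x₁ ∈ Icc (-(1 + 3 * C.δ)) (2 + 3 * C.δ)) : C.θaff x₁ ∈ C.I2 := by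
  have hs := C.slope_pos
  have hδ := C.δ_pos
  have e1 : (1 + 2 * C.δ) * (C.wid / (1 + 2 * C.δ)) = C.wid := by
    field_simp
  have hlo : -(1 + 2 * C.δ) * (C.wid / (1 + 2 * C.δ)) ≤ (x₁ + C.δ) * (C.wid / (1 + 2 * C.δ)) :=
    mul_le_mul_of_nonneg_right (by linarith [hx.1]) hs.le
  have hhi : (x₁ + C.δ) * (C.wid / (1 + 2 * C.δ)) ≤ (2 * (1 + 2 * C.δ)) * (C.wid / (1 + 2 * C.δ)) :=
    mul_le_mul_of_nonneg_right (by linarith [hx.2]) hs.le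
  simp only [I2, mem_Icc, θaff, wid] at e1 hlo hhi ⊢
  constructor <;> nlinarith

/-- **The clamp in the across-coordinate** `s = x 0`: a `C^∞` function equal to the identity
on `[-δ, 1 + δ]` with values in `(-2δ, 1 + 2δ)` (pole-free for every leaf). [folklore] -/
def clampS : ℝ → ℝ :=
  Classical.choose (exists_contDiff_clamp (a := -(2 * C.δ)) (a' := -C.δ)
    (b' := 1 + C.δ) (b := 1 + 2 * C.δ) (by linarith [C.δ_pos]) (by linarith [C.δ_pos])
    (by linarith [C.δ_pos]))

/-- The defining properties of `clampS`. [folklore] -/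
theorem clampS_spec : ContDiff ℝ ∞ C.clampS ∧ (∀ t ∈ Icc (-C.δ) (1 + C.δ), C.clampS t = t) ∧
    ∀ t, C.clampS t ∈ Ioo (-(2 * C.δ)) (1 + 2 * C.δ) :=
  Classical.choose_spec (exists_contDiff_clamp (a := -(2 * C.δ)) (a' := -C.δ)
    (b' := 1 + C.δ) (b := 1 + 2 * C.δ) (by linarith [C.δ_pos]) (by linarith [C.δ_pos])
    (by linarith [C.δ_pos]))

/-- `clampS` is the identity on `[-δ, 1 + δ]`. [folklore] -/
theorem clampS_eq {t : ℝ} (ht : t ∈ Icc (-C.δ) (1 + C.δ)) : C.clampS t = t := C.clampS_spec.2.1 t ht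

/-- `clampS` is the identity near every point of `(-δ, 1 + δ)`. [folklore] -/
theorem clampS_eventuallyEq {t : ℝ} (ht : t ∈ Ioo (-C.δ) (1 + C.δ)) : C.clampS =ᶠ[𝓝 t] id := by
  filter_upwards [isOpen_Ioo.mem_nhds ht] with s hs using C.clampS_eq ⟨hs.1.le, hs.2.le⟩

/-- **The clamp in the along-coordinate** `x 1`: a `C^∞` function equal to the identity on
`[-(1 + 2δ), 2 + 2δ]` with values in `(-(1 + 3δ), 2 + 3δ)` (so that the collar coordinate, and one
more unit on either side for the arcs, pass unchanged). [folklore] -/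
def clamp : ℝ → ℝ :=
  Classical.choose (exists_contDiff_clamp (a := -(1 + 3 * C.δ)) (a' := -(1 + 2 * C.δ))
    (b' := 2 + 2 * C.δ) (b := 2 + 3 * C.δ) (by linarith [C.δ_pos]) (by linarith [C.δ_pos])
    (by linarith [C.δ_pos]))

/-- The defining properties of the clamp. [folklore] -/
theorem clamp_spec : ContDiff ℝ ∞ C.clamp ∧ (∀ t ∈ Icc (-(1 + 2 * C.δ)) (2 + 2 * C.δ), C.clamp t = t) ∧
    ∀ t, C.clamp t ∈ Ioo (-(1 + 3 * C.δ)) (2 + 3 * C.δ) :=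
  Classical.choose_spec (exists_contDiff_clamp (a := -(1 + 3 * C.δ)) (a' := -(1 + 2 * C.δ))
    (b' := 2 + 2 * C.δ) (b := 2 + 3 * C.δ) (by linarith [C.δ_pos]) (by linarith [C.δ_pos])
    (by linarith [C.δ_pos]))

/-- The clamp is the identity on the collar coordinates `(-δ, 1 + δ)` and beyond. [folklore] -/
theorem clamp_eq {t : ℝ} (ht : t ∈ Icc (-(1 + 2 * C.δ)) (2 + 2 * C.δ)) : C.clamp t = t := C.clamp_spec.2.1 t ht

/-- The clamp is the identity near every point of the open collar range. [folklore] -/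
theorem clamp_eventuallyEq {t : ℝ} (ht : t ∈ Ioo (-(1 + 2 * C.δ)) (2 + 2 * C.δ)) : C.clamp =ᶠ[𝓝 t] id := by
  filter_upwards [isOpen_Ioo.mem_nhds ht] with s hs using C.clamp_eq ⟨hs.1.le, hs.2.le⟩

/-- **The angle of a point of the plane**: `Θ x = θaff (clamp (x 1))`. [folklore] -/
def Θ (x : EuclideanSpace ℝ (Fin 2)) : ℝ := C.θaff (C.clamp (x 1))

/-- **The height of the lower arc over a point**: `G x = circLow (Θ x)`. [folklore] -/
def G (x : EuclideanSpace ℝ (Fin 2)) : ℝ := circLow C.mθ C.md C.r (C.Θ x)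

/-- **The height of a point**: `F x = leaf a (G x) (clampS (x 0))`. [folklore] -/
def F (x : EuclideanSpace ℝ (Fin 2)) : ℝ := leaf C.a (C.G x) (C.clampS (x 0))

/-- The angle lies in the doubled interval. [folklore] -/
theorem Θ_mem (x : EuclideanSpace ℝ (Fin 2)) : C.Θ x ∈ C.I2 :=
  C.θaff_mem_I2 (Ioo_subset_Icc_self (C.clamp_spec.2.2 _))

/-- The lower arc height lies in `(a/2, a)`. [folklore] -/
theorem G_mem (x : EuclideanSpace ℝ (Fin 2)) : C.a / 2 < C.G x ∧ C.G x < C.a :=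
  ⟨C.low_gt _ (C.Θ_mem x), C.low_lt _ (C.Θ_mem x)⟩

/-- The clamped across-coordinate lies in the pole-free half-line of the leaf through `G x`.
[folklore] -/
theorem clampS_mem_polefree (x : EuclideanSpace ℝ (Fin 2)) (t : ℝ) :
    -(1 - C.G x / C.a) / 2 ≤ C.clampS t := by
  have h := C.room _ (C.Θ_mem x)
  have hc := (C.clampS_spec.2.2 t).1
  have ha := C.a_pos
  -- `1 - G/a ≥ 8δ`, so `-(1 - G/a)/2 ≤ -4δ < -2δ < clampS t`
  have h1 : 8 * C.δ ≤ 1 - C.G x / C.a := by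
    rw [G, le_sub_iff_add_le, ← le_sub_iff_add_le', div_le_iff₀ ha]
    nlinarith
  linarith [C.δ_pos]

/-! ### Smoothness of the coordinates -/

/-- The angle is `C^∞`. [folklore] -/
theorem contDiff_Θ : ContDiff ℝ ∞ C.Θ := by
  unfold Θ θaff
  have hp : ContDiff ℝ ∞ fun x : EuclideanSpace ℝ (Fin 2) ↦ x 1 :=
    (EuclideanSpace.proj (1 : Fin 2) : EuclideanSpace ℝ (Fin 2) →L[ℝ] ℝ).contDiff
  have h1 : ContDiff ℝ ∞ fun x : EuclideanSpace ℝ (Fin 2) ↦ C.clamp (x 1) := C.clamp_spec.1.comp hp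
  exact contDiff_const.add ((h1.add contDiff_const).mul contDiff_const)

/-- The lower arc height is `C^∞`. [folklore] -/
theorem contDiff_G : ContDiff ℝ ∞ C.G := by
  rw [contDiff_iff_contDiffAt]
  intro x
  exact (contDiffAt_circLow (C.sq_lt _ (C.Θ_mem x))).comp x C.contDiff_Θ.contDiffAt

/-- The denominator of the leaf through `G x` does not vanish at `clampS t`. [folklore] -/
theorem den_ne_zero (x : EuclideanSpace ℝ (Fin 2)) (t : ℝ) : den (C.G x / C.a) (C.clampS t) ≠ 0 := by
  have ha := C.a_pos
  obtain ⟨hg, hg'⟩ := C.G_mem x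
  have hq : 1 / 2 < C.G x / C.a := by rw [lt_div_iff₀ ha]; linarith
  have hq1 : C.G x / C.a < 1 := by rw [div_lt_one ha]; exact hg'
  exact (den_pos_of_ge hq hq1 (C.clampS_mem_polefree x t)).ne'

/-- The height is `C^∞`. [folklore] -/
theorem contDiff_F : ContDiff ℝ ∞ C.F := by
  rw [contDiff_iff_contDiffAt]
  intro x
  have hp : ContDiff ℝ ∞ fun x : EuclideanSpace ℝ (Fin 2) ↦ x 0 :=
    (EuclideanSpace.proj (0 : Fin 2) : EuclideanSpace ℝ (Fin 2) →L[ℝ] ℝ).contDiff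
  have h1 : ContDiffAt ℝ ∞ (fun y : EuclideanSpace ℝ (Fin 2) ↦ (C.G y, C.clampS (y 0))) x :=
    C.contDiff_G.contDiffAt.prodMk ((C.clampS_spec.1.comp hp).contDiffAt)
  have h2 : ContDiffAt ℝ ∞ ((fun p : ℝ × ℝ ↦ leaf C.a p.1 p.2) ∘
      fun y : EuclideanSpace ℝ (Fin 2) ↦ (C.G y, C.clampS (y 0))) x :=
    (contDiffAt_leaf (C.den_ne_zero x (x 0))).comp x h1
  exact h2

/-! ### The chart -/

/-- The standard basis vector `eᵢ` of `ℝ³`. [folklore] -/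
def e3 (i : Fin 3) : EuclideanSpace ℝ (Fin 3) := EuclideanSpace.single i 1

/-- **The foliated band chart** `B x = (Θ x, F x, 0) ∈ ℝ³` (in the plane `d₂ = 0`). [folklore] -/
def B (x : EuclideanSpace ℝ (Fin 2)) : EuclideanSpace ℝ (Fin 3) := C.Θ x • e3 0 + C.F x • e3 1

/-- First coordinate of the chart: the angle. [folklore] -/
@[simp] theorem B_apply_zero (x : EuclideanSpace ℝ (Fin 2)) : C.B x 0 = C.Θ x := by simp [B, e3]

/-- Second coordinate of the chart: the height. [folklore] -/
@[simp] theorem B_apply_one (x : EuclideanSpace ℝ (Fin 2)) : C.B x 1 = C.F x := by simp [B, e3]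

/-- Third coordinate of the chart: zero (the chart lies in the plane `d₂ = 0`). [folklore] -/
@[simp] theorem B_apply_two (x : EuclideanSpace ℝ (Fin 2)) : C.B x 2 = 0 := by simp [B, e3]

/-- The chart is `C^∞`. [folklore] -/
theorem contDiff_B : ContDiff ℝ ∞ C.B :=
  (C.contDiff_Θ.smul contDiff_const).add (C.contDiff_F.smul contDiff_const)

/-- On the closed collar the clamps are inactive: `Θ x = θaff (x 1)`. [folklore] -/
theorem Θ_eq {x : EuclideanSpace ℝ (Fin 2)} (hx : x 1 ∈ Icc (-(1 + 2 * C.δ)) (2 + 2 * C.δ)) :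
    C.Θ x = C.θaff (x 1) := by rw [Θ, C.clamp_eq hx]

/-- On the closed collar: `F x = leaf a (G x) (x 0)`. [folklore] -/
theorem F_eq {x : EuclideanSpace ℝ (Fin 2)} (hx : x 0 ∈ Icc (-C.δ) (1 + C.δ)) :
    C.F x = leaf C.a (C.G x) (x 0) := by rw [F, C.clampS_eq hx]

/-- **The left edge of the chart is the core line**: `F x = 0` when `x 0 = 0`. [folklore] -/
theorem F_of_zero {x : EuclideanSpace ℝ (Fin 2)} (hx : x 0 = 0) : C.F x = 0 := by
  rw [C.F_eq (by rw [hx]; exact ⟨by linarith [C.δ_pos], by linarith [C.δ_pos]⟩), hx, leaf_zero]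

/-- **The right edge of the chart is the line at height `a`**: `F x = a` when `x 0 = 1`. [folklore] -/
theorem F_of_one {x : EuclideanSpace ℝ (Fin 2)} (hx : x 0 = 1) : C.F x = C.a := by
  obtain ⟨hg, hg'⟩ := C.G_mem x
  rw [C.F_eq (by rw [hx]; exact ⟨by linarith [C.δ_pos], by linarith [C.δ_pos]⟩), hx,
    leaf_one C.a_pos.ne' (by linarith [C.a_pos])]

/-- **The middle line of the chart lies on the circle**: `F x = G x = circLow (Θ x)` when
`x 0 = 1/2`. [folklore] -/
theorem F_of_half {x : EuclideanSpace ℝ (Fin 2)} (hx : x 0 = 1 / 2) : C.F x = C.G x := by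
  rw [C.F_eq (by rw [hx]; exact ⟨by linarith [C.δ_pos], by linarith [C.δ_pos]⟩), hx, leaf_half C.a_pos.ne']

/-- **The chart crosses the circle exactly along its middle line.** For `x` in the closed collar,
`B x` lies on the circle iff `x 0 = 1/2`. [folklore] -/
theorem mem_circle_iff {x : EuclideanSpace ℝ (Fin 2)} (hx0 : x 0 ∈ Icc (-C.δ) (1 + C.δ)) :
    (C.B x 0 - C.mθ) ^ 2 + (C.B x 1 - C.md) ^ 2 = C.r ^ 2 ↔ x 0 = 1 / 2 := by
  have ha := C.a_pos
  obtain ⟨hg, hg'⟩ := C.G_mem x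
  have hΘ := C.Θ_mem x
  rw [B_apply_zero, B_apply_one, C.F_eq hx0]
  constructor
  · intro h
    -- the height is below the upper arc, hence on the lower arc
    have hup : leaf C.a (C.G x) (x 0) < C.md + Real.sqrt (C.r ^ 2 - (C.Θ x - C.mθ) ^ 2) := by
      refine lt_of_le_of_lt (leaf_le ha hg hg' C.δ_pos.le ?_ (by linarith [hx0.2, C.δ_pos])) (C.up _ hΘ)
      have := C.clampS_mem_polefree x (x 0)
      rwa [C.clampS_eq hx0] at this
    have heq := eq_circLow_of_mem h hup
    exact (leaf_eq_iff ha hg hg' (by have := C.clampS_mem_polefree x (x 0); rwa [C.clampS_eq hx0] at this)).1 heq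
  · intro h
    rw [h, leaf_half ha.ne']
    exact circLow_mem (C.sq_lt _ hΘ).le

/-- **The chart is injective on the closed collar.** [folklore] -/
theorem injOn_B : InjOn C.B {x | x 0 ∈ Icc (-C.δ) (1 + C.δ) ∧ x 1 ∈ Icc (-(1 + 2 * C.δ)) (2 + 2 * C.δ)} := by
  intro x hx y hy h
  have ha := C.a_pos
  have h0 : C.Θ x = C.Θ y := by simpa using congrArg (fun v : EuclideanSpace ℝ (Fin 3) ↦ v 0) h
  have h1 : C.F x = C.F y := by simpa using congrArg (fun v : EuclideanSpace ℝ (Fin 3) ↦ v 1) h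
  rw [C.Θ_eq hx.2, C.Θ_eq hy.2] at h0
  have hx1 : x 1 = y 1 := C.θaff_injective h0
  have hG : C.G x = C.G y := by
    rw [G, G, C.Θ_eq hx.2, C.Θ_eq hy.2, hx1]
  rw [C.F_eq hx.1, C.F_eq hy.1, hG] at h1
  obtain ⟨hg, hg'⟩ := C.G_mem y
  have hpf : ∀ {t : ℝ}, t ∈ Icc (-C.δ) (1 + C.δ) → -(1 - C.G y / C.a) / 2 ≤ t := fun {t} ht ↦ by
    have := C.clampS_mem_polefree y t; rwa [C.clampS_eq ht] at this
  have hx0 : x 0 = y 0 := (strictMonoOn_leaf ha hg hg').injOn (hpf hx.1) (hpf hy.1) h1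
  ext i; fin_cases i
  · exact hx0
  · exact hx1

/-! ### The chart is an immersion on the open collar -/

/-- The derivative of the angle on the open collar: `DΘ v = slope · v 1`. [folklore] -/
theorem hasFDerivAt_Θ {x : EuclideanSpace ℝ (Fin 2)} (hx1 : x 1 ∈ Ioo (-(1 + 2 * C.δ)) (2 + 2 * C.δ)) :
    HasFDerivAt C.Θ ((C.wid / (1 + 2 * C.δ)) • (EuclideanSpace.proj (1 : Fin 2) :
      EuclideanSpace ℝ (Fin 2) →L[ℝ] ℝ)) x := by
  have hev : C.Θ =ᶠ[𝓝 x] fun y ↦ C.θaff (y 1) := by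
    have ho : IsOpen {y : EuclideanSpace ℝ (Fin 2) | y 1 ∈ Ioo (-(1 + 2 * C.δ)) (2 + 2 * C.δ)} :=
      isOpen_Ioo.preimage (EuclideanSpace.proj (1 : Fin 2)).continuous
    filter_upwards [ho.mem_nhds hx1] with y hy using C.Θ_eq ⟨hy.1.le, hy.2.le⟩
  refine HasFDerivAt.congr_of_eventuallyEq ?_ hev
  have hp := (EuclideanSpace.proj (1 : Fin 2) : EuclideanSpace ℝ (Fin 2) →L[ℝ] ℝ).hasFDerivAt (x := x)
  have h := ((hp.add_const C.δ).mul_const (C.wid / (1 + 2 * C.δ))).const_add C.θlo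
  refine h.congr_fderiv ?_
  ext v
  simp [mul_comm]

/-- The derivative of the lower arc height kills vectors with `v 1 = 0`. [folklore] -/
theorem fderiv_G_apply_eq_zero {x : EuclideanSpace ℝ (Fin 2)}
    (hx1 : x 1 ∈ Ioo (-(1 + 2 * C.δ)) (2 + 2 * C.δ)) {v : EuclideanSpace ℝ (Fin 2)} (hv : v 1 = 0) :
    fderiv ℝ C.G x v = 0 := by
  have hc : HasDerivAt (circLow C.mθ C.md C.r) (deriv (circLow C.mθ C.md C.r) (C.Θ x)) (C.Θ x) :=
    ((contDiffAt_circLow (C.sq_lt _ (C.Θ_mem x))).differentiableAt (by simp)).hasDerivAt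
  have hG : HasFDerivAt C.G _ x := hc.hasFDerivAt.comp x (C.hasFDerivAt_Θ hx1)
  rw [hG.fderiv]
  simp [hv]

/-- The partial derivative of the two-variable leaf function in `s`. [folklore] -/
theorem fderiv_leaf₂_apply {a g s : ℝ} (hd : den (g / a) s ≠ 0) (c : ℝ) :
    fderiv ℝ (fun p : ℝ × ℝ ↦ leaf a p.1 p.2) (g, s) ((0 : ℝ), c) = c * deriv (leaf a g) s := by
  have hL : DifferentiableAt ℝ (fun p : ℝ × ℝ ↦ leaf a p.1 p.2) (g, s) :=
    (contDiffAt_leaf hd).differentiableAt (by simp)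
  -- restrict to the line `t ↦ (g, s + t c)`... directly: chain rule along `t ↦ (g, t)`
  have hincl : HasDerivAt (fun t : ℝ ↦ ((g, t) : ℝ × ℝ)) ((0 : ℝ), (1 : ℝ)) s :=
    (hasDerivAt_const s g).prodMk (hasDerivAt_id s)
  have hcomp := hL.hasFDerivAt.comp_hasDerivAt s hincl
  have h1 : deriv (leaf a g) s = fderiv ℝ (fun p : ℝ × ℝ ↦ leaf a p.1 p.2) (g, s) ((0 : ℝ), (1 : ℝ)) := by
    rw [← hcomp.deriv]; rfl
  rw [h1, ← smul_eq_mul, ← map_smul]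
  congr 1
  simp

/-- **The chart is an immersion on the open collar.** [folklore] -/
theorem injective_fderiv_B {x : EuclideanSpace ℝ (Fin 2)} (hx0 : x 0 ∈ Ioo (-C.δ) (1 + C.δ))
    (hx1 : x 1 ∈ Ioo (-(1 + 2 * C.δ)) (2 + 2 * C.δ)) : Injective (fderiv ℝ C.B x) := by
  have ha := C.a_pos
  obtain ⟨hg, hg'⟩ := C.G_mem x
  -- `F` near `x` is the two-variable leaf function composed with `(G, proj₀)`
  have hFev : C.F =ᶠ[𝓝 x] ((fun p : ℝ × ℝ ↦ leaf C.a p.1 p.2) ∘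
      fun y : EuclideanSpace ℝ (Fin 2) ↦ ((C.G y, y 0) : ℝ × ℝ)) := by
    have ho : IsOpen {y : EuclideanSpace ℝ (Fin 2) | y 0 ∈ Ioo (-C.δ) (1 + C.δ)} :=
      isOpen_Ioo.preimage (EuclideanSpace.proj (0 : Fin 2)).continuous
    filter_upwards [ho.mem_nhds hx0] with y hy using C.F_eq ⟨hy.1.le, hy.2.le⟩
  have hd : den (C.G x / C.a) (x 0) ≠ 0 := by
    have := C.den_ne_zero x (x 0); rwa [C.clampS_eq ⟨hx0.1.le, hx0.2.le⟩] at this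
  have hL : DifferentiableAt ℝ (fun p : ℝ × ℝ ↦ leaf C.a p.1 p.2) (C.G x, x 0) :=
    (contDiffAt_leaf hd).differentiableAt (by simp)
  have hGd : DifferentiableAt ℝ C.G x := (C.contDiff_G.differentiable (by simp)) x
  have hp0 := (EuclideanSpace.proj (0 : Fin 2) : EuclideanSpace ℝ (Fin 2) →L[ℝ] ℝ).hasFDerivAt (x := x)
  have hinner : HasFDerivAt (fun y : EuclideanSpace ℝ (Fin 2) ↦ ((C.G y, y 0) : ℝ × ℝ))
      ((fderiv ℝ C.G x).prod (EuclideanSpace.proj (0 : Fin 2))) x :=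
    hGd.hasFDerivAt.prodMk hp0
  have hF : HasFDerivAt C.F ((fderiv ℝ (fun p : ℝ × ℝ ↦ leaf C.a p.1 p.2) (C.G x, x 0)).comp
      ((fderiv ℝ C.G x).prod (EuclideanSpace.proj (0 : Fin 2)))) x :=
    (hL.hasFDerivAt.comp x hinner).congr_of_eventuallyEq hFev
  have hΘ := C.hasFDerivAt_Θ hx1
  have hB : HasFDerivAt C.B _ x := (hΘ.smul_const (e3 0)).add (hF.smul_const (e3 1))
  rw [hB.fderiv]
  intro v w hvw
  rw [← sub_eq_zero] at hvw ⊢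
  rw [← map_sub] at hvw
  set u := v - w with hu
  -- coordinate `0`: the angle component
  have h0 := congrArg (fun z : EuclideanSpace ℝ (Fin 3) ↦ z 0) hvw
  simp [e3] at h0
  have hu1 : u 1 = 0 := by
    rcases h0 with h0 | h0
    · exfalso
      rcases h0 with h0 | h0
      · exact C.wid_pos.ne' h0
      · linarith [C.δ_pos]
    · exact h0
  -- coordinate `1`: the height component
  have h1 := congrArg (fun z : EuclideanSpace ℝ (Fin 3) ↦ z 1) hvw
  simp [e3] at h1
  rw [C.fderiv_G_apply_eq_zero hx1 hu1, fderiv_leaf₂_apply hd] at h1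
  have hpos := deriv_leaf_pos ha hg hg' (s := x 0) (by
    have := C.clampS_mem_polefree x (x 0); rwa [C.clampS_eq ⟨hx0.1.le, hx0.2.le⟩] at this)
  have hu0 : u 0 = 0 := by
    rcases mul_eq_zero.1 h1 with h | h
    · exact h
    · exact absurd h hpos.ne'
  ext i; fin_cases i
  · exact hu0
  · exact hu1

end ChartData

end BandFoliation

end Literature.Topology.FourManifolds
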